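import Mathlib
import HarnessLib
import Summits.HubbardSuperconductivity.HubbardSuperconductivity.Theorems.KLProgrammeKLRegimeEngineSliceCovAmpAtoms
import Summits.HubbardSuperconductivity.HubbardSuperconductivity.Theorems.KLProgrammeKLRegimeEngineSliceCovAmpRef
import Summits.HubbardSuperconductivity.HubbardSuperconductivity.Theorems.KLProgrammeKLRegimeSectorSliceDefectRatePack
import Summits.HubbardSuperconductivity.HubbardSuperconductivity.Theorems.KLProgrammeKLRegimeSectorSlicePairWtFat

/-!
# Route `KLProgramme` — crux K3 ENGINE (stmt-HubbardSuperconductivity-20437) stub (b) conj. 2 «(c-D)² FAMILY TELESCOPE», brick (D5q): the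
# AMPLITUDE PACK — the covariance piece's closed amplitude `A₀^♯(x₀)` of `rowSumWt_sliceCT_famBand_tel_le` (its binder spelling, `N_r = 2`,
# `Λ_m = lam`, `c = βL²`, `P2M = 2M`, `L = Lr`) is `≤ (G₀/x₀²)/(cΛ²)·𝒜` with `𝒜` scale-free

Cell `gate-hubbard-kl`, seat hubbard-kl-k3c3-p2 (g11); F1-DESIGN §10.  Chains `rateAmps_pack'` (`L·A ≤ a`), `covAe_le'` (`a ≤ 𝔞/Λ_m^{1,2}`, here),
`covX_le` (`X_k ≤ cPx₀^k𝔛_k/Λ²`, `T_t`), the `κ`-slot `(κ_A + κ_B)/(Λ_m³x₀³) ≤ κ_A + 16G₁^p𝔞₃` (`a₃^♯ ≤ 𝔞₃Λ_m²`, `1 ≤ Λ_m²x₀`), and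
`covDefect_ampRef_le`.

* `covAe_le'`; **`covTel_amp_pack`** — `A₀^♯(x₀) ≤ (G₀/x₀²)/(cΛ²)·𝒜`.

Pure bookkeeping; no definitions, no sorry. [folklore]
-/

noncomputable section

namespace Summit.HubbardSuperconductivity.HubbardSuperconductivity.Theorems.TorusFourierL2

set_option linter.dupNamespace false -- summit = problem name (single-conjunct summit), D-0017

open Real Literature.MathematicalPhysics.QuantumLattice Literature.MathematicalPhysics.QuantumLattice.BandSectorCounting

/-- **The `L`-free direction amplitudes of `rateAmps_pack'` are `≤ 𝔞/Λ_m`, `𝔞/Λ_m²`** (`ρ_f ≤ ρ_f^M`, `w_{si}Λ_m ≤ w₀`, `Λ_m ≤ 1`; this is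
`covAe_le` of `…CovAmpAtoms` with the second-order slots in the exact spelling of `rateAmps_pack'`). [folklore] -/
theorem covAe_le' {lam A Ba Kp wsi w₀ ρf ρfM Gp₁ Gp₂ ae1 ae2 an1 an2 av1 av2 : ℝ} (hlam : 0 < lam) (hlam1 : lam ≤ 1) (hA : 0 ≤ A) (hBa : 0 ≤ Ba)
    (hKp : 0 ≤ Kp) (hwsi : 0 ≤ wsi) (hw : wsi * lam ≤ w₀) (hρf : 0 ≤ ρf) (hρfM : ρf ≤ ρfM) (hGp₁ : 0 ≤ Gp₁) (hGp₂ : 0 ≤ Gp₂)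
    (hae1 : ae1 = 2 * Gp₁ * ((4 + 2 * A) * (2 * π) + Kp * (ρf + 4 * π) * (2 * π)) / lam + 9 * (4 * Ba * ((1 + 2 * wsi) * (2 * (2 * π)))))
    (hae2 : ae2 = (4 * Gp₂ + 2 * Gp₁) * ((4 + 2 * A) * (2 * π) + Kp * (ρf + 4 * π) * (2 * π)) ^ 2 / lam ^ 2 + 2 * Gp₁ * (Kp * (2 * π) ^ 2) / lam +
      4 * Gp₁ * ((4 + 2 * A) * (2 * π) + Kp * (ρf + 4 * π) * (2 * π)) / lam * (9 * (4 * Ba * ((1 + 2 * wsi) * (2 * (2 * π))))) +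
      9 * (4 * Ba * ((1 + 2 * wsi) * (2 * (2 * π))) ^ 2 + 8 * Ba ^ 2 * ((1 + 2 * wsi) * (2 * (2 * π))) ^ 2))
    (han1 : an1 = 2 * Gp₁ * ((4 + 2 * A) * (5 * π) + Kp * (ρf + 10 * π) * (5 * π)) / lam + 9 * (4 * Ba * ((1 + 2 * wsi) * (2 * (5 * π)))))
    (han2 : an2 = (4 * Gp₂ + 2 * Gp₁) * ((4 + 2 * A) * (5 * π) + Kp * (ρf + 10 * π) * (5 * π)) ^ 2 / lam ^ 2 + 2 * Gp₁ * (Kp * (5 * π) ^ 2) / lam +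
      4 * Gp₁ * ((4 + 2 * A) * (5 * π) + Kp * (ρf + 10 * π) * (5 * π)) / lam * (9 * (4 * Ba * ((1 + 2 * wsi) * (2 * (5 * π))))) +
      9 * (4 * Ba * ((1 + 2 * wsi) * (2 * (5 * π))) ^ 2 + 8 * Ba ^ 2 * ((1 + 2 * wsi) * (2 * (5 * π))) ^ 2))
    (hav1 : av1 = 2 * Gp₁ * ((2 * π) * (4 + 2 * A) + Kp * (ρf + 10 * π) * (5 * π)) / lam + 9 * (4 * Ba * ((1 + 2 * wsi) * (2 * (5 * π)))))
    (hav2 : av2 = (4 * Gp₂ + 2 * Gp₁) * ((2 * π) * (4 + 2 * A) + Kp * (ρf + 10 * π) * (5 * π)) ^ 2 / lam ^ 2 + 2 * Gp₁ * (Kp * (5 * π) ^ 2) / lam +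
      4 * Gp₁ * ((2 * π) * (4 + 2 * A) + Kp * (ρf + 10 * π) * (5 * π)) / lam * (9 * (4 * Ba * ((1 + 2 * wsi) * (2 * (5 * π))))) +
      9 * (4 * Ba * ((1 + 2 * wsi) * (2 * (5 * π))) ^ 2 + 8 * Ba ^ 2 * ((1 + 2 * wsi) * (2 * (5 * π))) ^ 2)) :
    ae1 ≤ (2 * Gp₁ * ((4 + 2 * A) * (2 * π) + Kp * (ρfM + 4 * π) * (2 * π)) + 9 * (4 * Ba * ((1 + 2 * w₀) * (2 * (2 * π))))) / lam ∧
    ae2 ≤ ((4 * Gp₂ + 2 * Gp₁) * ((4 + 2 * A) * (2 * π) + Kp * (ρfM + 4 * π) * (2 * π)) ^ 2 + 2 * Gp₁ * (Kp * (2 * π) ^ 2) +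
      4 * Gp₁ * ((4 + 2 * A) * (2 * π) + Kp * (ρfM + 4 * π) * (2 * π)) * (9 * (4 * Ba * ((1 + 2 * w₀) * (2 * (2 * π))))) +
      9 * (4 * Ba * ((1 + 2 * w₀) * (2 * (2 * π))) ^ 2 + 8 * Ba ^ 2 * ((1 + 2 * w₀) * (2 * (2 * π))) ^ 2)) / lam ^ 2 ∧
    an1 ≤ (2 * Gp₁ * ((4 + 2 * A) * (5 * π) + Kp * (ρfM + 10 * π) * (5 * π)) + 9 * (4 * Ba * ((1 + 2 * w₀) * (2 * (5 * π))))) / lam ∧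
    an2 ≤ ((4 * Gp₂ + 2 * Gp₁) * ((4 + 2 * A) * (5 * π) + Kp * (ρfM + 10 * π) * (5 * π)) ^ 2 + 2 * Gp₁ * (Kp * (5 * π) ^ 2) +
      4 * Gp₁ * ((4 + 2 * A) * (5 * π) + Kp * (ρfM + 10 * π) * (5 * π)) * (9 * (4 * Ba * ((1 + 2 * w₀) * (2 * (5 * π))))) +
      9 * (4 * Ba * ((1 + 2 * w₀) * (2 * (5 * π))) ^ 2 + 8 * Ba ^ 2 * ((1 + 2 * w₀) * (2 * (5 * π))) ^ 2)) / lam ^ 2 ∧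
    av1 ≤ (2 * Gp₁ * ((2 * π) * (4 + 2 * A) + Kp * (ρfM + 10 * π) * (5 * π)) + 9 * (4 * Ba * ((1 + 2 * w₀) * (2 * (5 * π))))) / lam ∧
    av2 ≤ ((4 * Gp₂ + 2 * Gp₁) * ((2 * π) * (4 + 2 * A) + Kp * (ρfM + 10 * π) * (5 * π)) ^ 2 + 2 * Gp₁ * (Kp * (5 * π) ^ 2) +
      4 * Gp₁ * ((2 * π) * (4 + 2 * A) + Kp * (ρfM + 10 * π) * (5 * π)) * (9 * (4 * Ba * ((1 + 2 * w₀) * (2 * (5 * π))))) +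
      9 * (4 * Ba * ((1 + 2 * w₀) * (2 * (5 * π))) ^ 2 + 8 * Ba ^ 2 * ((1 + 2 * w₀) * (2 * (5 * π))) ^ 2)) / lam ^ 2 := by
  have hπ := Real.pi_pos
  have hw₀ : 0 ≤ w₀ := (mul_nonneg hwsi hlam.le).trans hw
  have hW : 1 + 2 * wsi ≤ (1 + 2 * w₀) / lam := by
    rw [le_div_iff₀ hlam]; nlinarith only [hw, hlam1, hlam, hwsi]
  have first : ∀ {p q θ : ℝ}, 0 ≤ p → 0 ≤ q → 0 ≤ θ →
      2 * Gp₁ * (p * (4 + 2 * A) + Kp * (ρf + q) * θ) / lam + 9 * (4 * Ba * ((1 + 2 * wsi) * (2 * θ))) ≤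
        (2 * Gp₁ * (p * (4 + 2 * A) + Kp * (ρfM + q) * θ) + 9 * (4 * Ba * ((1 + 2 * w₀) * (2 * θ)))) / lam := by
    intro p q θ hp hq hθ
    rw [add_div]
    have u1 : 2 * Gp₁ * (p * (4 + 2 * A) + Kp * (ρf + q) * θ) / lam ≤ 2 * Gp₁ * (p * (4 + 2 * A) + Kp * (ρfM + q) * θ) / lam := by gcongr
    have u2 : 9 * (4 * Ba * ((1 + 2 * wsi) * (2 * θ))) ≤ 9 * (4 * Ba * ((1 + 2 * w₀) * (2 * θ))) / lam := by
      rw [show 9 * (4 * Ba * ((1 + 2 * w₀) * (2 * θ))) / lam = 9 * (4 * Ba * (((1 + 2 * w₀) / lam) * (2 * θ))) by ring]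
      gcongr
    exact add_le_add u1 u2
  have second : ∀ {p q θ : ℝ}, 0 ≤ p → 0 ≤ q → 0 ≤ θ →
      (4 * Gp₂ + 2 * Gp₁) * (p * (4 + 2 * A) + Kp * (ρf + q) * θ) ^ 2 / lam ^ 2 + 2 * Gp₁ * (Kp * θ ^ 2) / lam +
        4 * Gp₁ * (p * (4 + 2 * A) + Kp * (ρf + q) * θ) / lam * (9 * (4 * Ba * ((1 + 2 * wsi) * (2 * θ)))) +
        9 * (4 * Ba * ((1 + 2 * wsi) * (2 * θ)) ^ 2 + 8 * Ba ^ 2 * ((1 + 2 * wsi) * (2 * θ)) ^ 2) ≤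
      ((4 * Gp₂ + 2 * Gp₁) * (p * (4 + 2 * A) + Kp * (ρfM + q) * θ) ^ 2 + 2 * Gp₁ * (Kp * θ ^ 2) +
        4 * Gp₁ * (p * (4 + 2 * A) + Kp * (ρfM + q) * θ) * (9 * (4 * Ba * ((1 + 2 * w₀) * (2 * θ)))) +
        9 * (4 * Ba * ((1 + 2 * w₀) * (2 * θ)) ^ 2 + 8 * Ba ^ 2 * ((1 + 2 * w₀) * (2 * θ)) ^ 2)) / lam ^ 2 := by
    intro p q θ hp hq hθ
    set E : ℝ := p * (4 + 2 * A) + Kp * (ρf + q) * θ with hE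
    set EM : ℝ := p * (4 + 2 * A) + Kp * (ρfM + q) * θ with hEM
    have hE0 : 0 ≤ E := by positivity
    have hEE : E ≤ EM := by rw [hE, hEM]; gcongr
    have hEM0 : 0 ≤ EM := hE0.trans hEE
    have hl12 : 1 / lam ≤ 1 / lam ^ 2 := by
      rw [div_le_div_iff₀ hlam (by positivity)]; nlinarith only [hlam1, hlam]
    have v1 : (4 * Gp₂ + 2 * Gp₁) * E ^ 2 / lam ^ 2 ≤ (4 * Gp₂ + 2 * Gp₁) * EM ^ 2 / lam ^ 2 := by gcongr
    have v2 : 2 * Gp₁ * (Kp * θ ^ 2) / lam ≤ 2 * Gp₁ * (Kp * θ ^ 2) / lam ^ 2 := by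
      rw [div_eq_mul_one_div, div_eq_mul_one_div _ (lam ^ 2)]; exact mul_le_mul_of_nonneg_left hl12 (by positivity)
    have v3 : 4 * Gp₁ * E / lam * (9 * (4 * Ba * ((1 + 2 * wsi) * (2 * θ)))) ≤ 4 * Gp₁ * EM * (9 * (4 * Ba * ((1 + 2 * w₀) * (2 * θ)))) / lam ^ 2 := by
      have w1 : 4 * Gp₁ * E / lam ≤ 4 * Gp₁ * EM / lam := by gcongr
      have w2 : 9 * (4 * Ba * ((1 + 2 * wsi) * (2 * θ))) ≤ 9 * (4 * Ba * (((1 + 2 * w₀) / lam) * (2 * θ))) := by gcongr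
      calc 4 * Gp₁ * E / lam * (9 * (4 * Ba * ((1 + 2 * wsi) * (2 * θ)))) ≤ 4 * Gp₁ * EM / lam * (9 * (4 * Ba * (((1 + 2 * w₀) / lam) * (2 * θ)))) :=
            mul_le_mul w1 w2 (by positivity) (div_nonneg (mul_nonneg (by positivity) hEM0) hlam.le)
        _ = _ := by field_simp
    have hz : ((1 + 2 * wsi) * (2 * θ)) ^ 2 ≤ (((1 + 2 * w₀) / lam) * (2 * θ)) ^ 2 := by gcongr
    have v4 : 9 * (4 * Ba * ((1 + 2 * wsi) * (2 * θ)) ^ 2 + 8 * Ba ^ 2 * ((1 + 2 * wsi) * (2 * θ)) ^ 2) ≤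
        9 * (4 * Ba * ((1 + 2 * w₀) * (2 * θ)) ^ 2 + 8 * Ba ^ 2 * ((1 + 2 * w₀) * (2 * θ)) ^ 2) / lam ^ 2 := by
      calc _ ≤ 9 * (4 * Ba * (((1 + 2 * w₀) / lam) * (2 * θ)) ^ 2 + 8 * Ba ^ 2 * (((1 + 2 * w₀) / lam) * (2 * θ)) ^ 2) := by gcongr
        _ = _ := by field_simp
    rw [add_div, add_div, add_div]
    linarith [v1, v2, v3, v4]
  have e2π : (4 + 2 * A) * (2 * π) = (2 * π) * (4 + 2 * A) := mul_comm _ _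
  have e5π : (4 + 2 * A) * (5 * π) = (5 * π) * (4 + 2 * A) := mul_comm _ _
  refine ⟨?_, ?_, ?_, ?_, ?_, ?_⟩
  · rw [hae1, e2π]; exact first (p := 2 * π) (q := 4 * π) (θ := 2 * π) (by positivity) (by positivity) (by positivity)
  · rw [hae2, e2π]; exact second (p := 2 * π) (q := 4 * π) (θ := 2 * π) (by positivity) (by positivity) (by positivity)
  · rw [han1, e5π]; exact first (p := 5 * π) (q := 10 * π) (θ := 5 * π) (by positivity) (by positivity) (by positivity)
  · rw [han2, e5π]; exact second (p := 5 * π) (q := 10 * π) (θ := 5 * π) (by positivity) (by positivity) (by positivity)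
  · rw [hav1]; exact first (p := 2 * π) (q := 10 * π) (θ := 5 * π) (by positivity) (by positivity) (by positivity)
  · rw [hav2]; exact second (p := 2 * π) (q := 10 * π) (θ := 5 * π) (by positivity) (by positivity) (by positivity)

section Pack

set_option maxHeartbeats 1000000 -- the long binder list

variable {A lam e₀ d Ba Ba3 ε₂ ρf Kb₁ Kb₂ K₃s Λ c β P2M Lr x₀ G₀ Gi₁ Gi₂ Gi₃ a₃s B₁ B₂ B₃ B₄ : ℝ} {m : ℕ}

-- the COVARIANCE piece's names (as in `rowSumWt_sliceCT_famBand_tel_le` at `N_r = 2`)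
variable {ℓ₁ ℓ Gp₁ Gp₂ Gp₃ wsi τt Ae1 Ae2 An1 An2 Av1 Av2 : ℝ}
  (hℓ₁ : ℓ₁ = 2 * π / Lr) (hℓ : ℓ = 2 * π / Lr * (2 + 1 / 2))
  (hGp₁ : Gp₁ = d * e₀ ^ 2 * 1 + 1 * (d * e₀ ^ 2)) (hGp₂ : Gp₂ = d * e₀ ^ 4 * 1 + 2 * (d * e₀ ^ 2) * (d * e₀ ^ 2) + 1 * (d * e₀ ^ 4))
  (hGp₃ : Gp₃ = d * e₀ ^ 6 * 1 + 3 * (d * e₀ ^ 4) * (d * e₀ ^ 2) + 3 * (d * e₀ ^ 2) * (d * e₀ ^ 4) + 1 * (d * e₀ ^ 6))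
  (hwsi : wsi = (sectorWidth (m + 1))⁻¹)
  (hτt : τt = |2 * π / Lr| * (4 + 2 * A) + Kb₂ * (Real.sqrt 2 * ρf) * (Real.sqrt 2 * ℓ))
  (hAe1 : Ae1 = 2 * Gp₁ * ((4 + 2 * A) * ℓ₁ + ε₂ * (ρf + 2 * ℓ₁) * ℓ₁) / lam * 1 + 1 * 1 * (9 * (4 * Ba * ((1 + 2 * wsi) * (2 * ℓ₁)))))
  (hAe2 : Ae2 = ((4 * Gp₂ + 2 * Gp₁) * ((4 + 2 * A) * ℓ₁ + ε₂ * (ρf + 2 * ℓ₁) * ℓ₁) ^ 2 / lam ^ 2 + 2 * Gp₁ * (ε₂ * ℓ₁ ^ 2) / lam) * 1 +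
    4 * Gp₁ * ((4 + 2 * A) * ℓ₁ + ε₂ * (ρf + 2 * ℓ₁) * ℓ₁) / lam * (9 * (4 * Ba * ((1 + 2 * wsi) * (2 * ℓ₁)))) +
    1 * 1 * (9 * (4 * Ba * ((1 + 2 * wsi) * (2 * ℓ₁)) ^ 2 + 8 * Ba ^ 2 * ((1 + 2 * wsi) * (2 * ℓ₁)) ^ 2)))
  (hAn1 : An1 = 2 * Gp₁ * ((4 + 2 * A) * ℓ + ε₂ * (ρf + 2 * ℓ) * ℓ) / lam * 1 + 1 * 1 * (9 * (4 * Ba * ((1 + 2 * wsi) * (2 * ℓ)))))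
  (hAn2 : An2 = ((4 * Gp₂ + 2 * Gp₁) * ((4 + 2 * A) * ℓ + ε₂ * (ρf + 2 * ℓ) * ℓ) ^ 2 / lam ^ 2 + 2 * Gp₁ * (ε₂ * ℓ ^ 2) / lam) * 1 +
    4 * Gp₁ * ((4 + 2 * A) * ℓ + ε₂ * (ρf + 2 * ℓ) * ℓ) / lam * (9 * (4 * Ba * ((1 + 2 * wsi) * (2 * ℓ)))) +
    1 * 1 * (9 * (4 * Ba * ((1 + 2 * wsi) * (2 * ℓ)) ^ 2 + 8 * Ba ^ 2 * ((1 + 2 * wsi) * (2 * ℓ)) ^ 2)))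
  (hAv1 : Av1 = 2 * Gp₁ * (|2 * π / Lr| * (4 + 2 * A) + ε₂ * (ρf + 2 * ℓ) * ℓ) / lam * 1 + 1 * 1 * (9 * (4 * Ba * ((1 + 2 * wsi) * (2 * ℓ)))))
  (hAv2 : Av2 = ((4 * Gp₂ + 2 * Gp₁) * (|2 * π / Lr| * (4 + 2 * A) + ε₂ * (ρf + 2 * ℓ) * ℓ) ^ 2 / lam ^ 2 + 2 * Gp₁ * (ε₂ * ℓ ^ 2) / lam) * 1 +
    4 * Gp₁ * (|2 * π / Lr| * (4 + 2 * A) + ε₂ * (ρf + 2 * ℓ) * ℓ) / lam * (9 * (4 * Ba * ((1 + 2 * wsi) * (2 * ℓ)))) +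
    1 * 1 * (9 * (4 * Ba * ((1 + 2 * wsi) * (2 * ℓ)) ^ 2 + 8 * Ba ^ 2 * ((1 + 2 * wsi) * (2 * ℓ)) ^ 2)))
  -- the defect polynomials and time amplitude at the reference scale
  {X₀s X₁s X₂s X₃s Tts : ℝ}
  (hX₀s : X₀s = (16 * B₁ + 16) * c / Λ ^ 2 * (G₀ / x₀ ^ 2))
  (hX₁s : X₁s = (32 * B₂ + 144 * B₁ + 128) * c / Λ ^ 3 * (G₀ / x₀ ^ 2) * (Kb₁ + (Gi₁ / x₀)) + (16 * B₁ + 16) * c / Λ ^ 2 * (Gi₁ / x₀))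
  (hX₂s : X₂s = (64 * B₃ + 480 * B₂ + 1728 * B₁ + 1536) * c / Λ ^ 4 * (G₀ / x₀ ^ 2) * (Kb₁ + (Gi₁ / x₀)) ^ 2 +
    (32 * B₂ + 144 * B₁ + 128) * c / Λ ^ 3 * ((Gi₁ / x₀) * (2 * Kb₁ + (Gi₁ / x₀))) +
    ((32 * B₂ + 144 * B₁ + 128) * c / Λ ^ 3 * (G₀ / x₀ ^ 2) * (Kb₂ + Gi₂) + (16 * B₁ + 16) * c / Λ ^ 2 * Gi₂))
  (hX₃s : X₃s = (128 * B₄ + 1408 * B₃ + 7776 * B₂ + 27648 * B₁ + 24576) * c / Λ ^ 5 * (G₀ / x₀ ^ 2) * (Kb₁ + (Gi₁ / x₀)) ^ 3 +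
    (64 * B₃ + 480 * B₂ + 1728 * B₁ + 1536) * c / Λ ^ 4 * ((Gi₁ / x₀) * (3 * Kb₁ ^ 2 + 3 * Kb₁ * (Gi₁ / x₀) + (Gi₁ / x₀) ^ 2)) +
    3 * ((64 * B₃ + 480 * B₂ + 1728 * B₁ + 1536) * c / Λ ^ 4 * (G₀ / x₀ ^ 2) * ((Kb₁ + (Gi₁ / x₀)) * (Kb₂ + Gi₂)) +
      (32 * B₂ + 144 * B₁ + 128) * c / Λ ^ 3 * (Kb₁ * Gi₂ + (Gi₁ / x₀) * Kb₂ + (Gi₁ / x₀) * Gi₂)) +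
    ((32 * B₂ + 144 * B₁ + 128) * c / Λ ^ 3 * (G₀ / x₀ ^ 2) * ((K₃s * x₀) + (Gi₃ * x₀)) + (16 * B₁ + 16) * c / Λ ^ 2 * (Gi₃ * x₀)))
  (hTts : Tts = (1 / c) ^ 2 *
    (1 * ((2 * π / β) ^ 3 * ((128 * B₄ + 1216 * B₃ + 6912 * B₂ + 26112 * B₁ + 24576) * c / Λ ^ 5 * (G₀ / x₀ ^ 2))) +
      3 * ((2 * Gp₁ * |2 * π / β| * 1 / lam) * ((2 * π / β) ^ 2 * ((64 * B₃ + 416 * B₂ + 1600 * B₁ + 1536) * c / Λ ^ 4 * (G₀ / x₀ ^ 2)))) +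
      3 * (((4 * Gp₂ + 2 * Gp₁) * (2 * π / β) ^ 2 * 1 / lam ^ 2) * ((2 * π / β) * ((32 * B₂ + 128 * B₁ + 128) * c / Λ ^ 3 * (G₀ / x₀ ^ 2)))) +
      ((8 * Gp₃ + 12 * Gp₂) * |2 * π / β| ^ 3 * 1 / lam ^ 3) * ((16 * B₁ + 16) * c / Λ ^ 2 * (G₀ / x₀ ^ 2))))

  -- the rates and the closed amplitude at the reference scale
  {s₀ ρ ρ₃ : ℝ} (hs₀ : 0 < s₀) (hρ : 0 < ρ) (hρ₃ : 0 < ρ₃)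
  {κA κB AΔs : ℝ}
  (hκA : κA = (8 * Gp₃ + 12 * Gp₂) * (4 + 2 * A) ^ 3 + (12 * Gp₂ + 6 * Gp₁) * (4 + 2 * A) * (4 + 4 * A) * e₀ + 2 * Gp₁ * (4 * e₀ ^ 2) +
      216 * 9 * Ba3 * ((4 * Gp₂ + 2 * Gp₁) * (4 + 2 * A) ^ 2 * (2 * e₀) + 2 * Gp₁ * (4 + 4 * A) * e₀ * (2 * e₀)) +
      216 * 9 * Gp₁ * (4 + 2 * A) * (12 * Ba3 + 72 * Ba3 ^ 2) * (2 * e₀) ^ 2 + 216 * 9 * (12 * Ba3 + 216 * Ba3 ^ 2) * (2 * e₀) ^ 3)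
  (hκB : κB = 2 * Gp₁ * (8 * (a₃s * x₀)))
  (hAΔs : AΔs = (1 / c) ^ 2 * X₀s + Tts / (4 / (s₀ * P2M)) ^ 3 +
      (1 / c) ^ 2 * ((Real.sqrt 2 * ℓ₁) ^ 3 * X₃s + 3 * (Ae1 * ((Real.sqrt 2 * ℓ₁) ^ 2 * X₂s)) +
        3 * (Ae2 * ((Real.sqrt 2 * ℓ₁) * X₁s)) + (κA + κB) * ℓ₁ ^ 3 / lam ^ 3 * X₀s) / (4 / (ρ / x₀ * Lr)) ^ 3 +
      (1 / c) ^ 2 * ((Real.sqrt 2 * ℓ) ^ 3 * X₃s + 3 * (An1 * ((Real.sqrt 2 * ℓ) ^ 2 * X₂s)) +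
        3 * (An2 * ((Real.sqrt 2 * ℓ) * X₁s)) + (κA + κB) * ℓ ^ 3 / lam ^ 3 * X₀s) / (4 / (ρ / x₀ / (2 - 1) * Lr)) ^ 3 +
      (1 / c) ^ 2 * ((Real.sqrt 2 * ℓ) ^ 2 * X₂s + 2 * (Av1 * ((Real.sqrt 2 * ℓ) * X₁s)) + Av2 * X₀s) / (4 / (ρ₃ / x₀ / (2 - 1) * Lr)) ^ 2 +
      (1 / c) ^ 2 * ((Real.sqrt 2 * ℓ) ^ 3 * X₃s + 3 * (Av1 * ((Real.sqrt 2 * ℓ) ^ 2 * X₂s)) +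
        3 * (Av2 * ((Real.sqrt 2 * ℓ) * X₁s)) + (κA + κB) * ℓ ^ 3 / lam ^ 3 * X₀s) / (4 / (ρ / x₀ / (2 - 1) * Lr)) ^ 3)


include hℓ₁ hℓ hGp₁ hGp₂ hGp₃ hAe1 hAe2 hAn1 hAn2 hAv1 hAv2 hX₀s hX₁s hX₂s hX₃s hTts hs₀ hρ hκA hκB hAΔs in
set_option maxHeartbeats 4000000 in
/-- **The amplitude pack of the family telescope** (see the module docstring). [folklore] -/
theorem covTel_amp_pack {g₀ γ₁ γ₂ γ₃ w₀ ρfM 𝔞₃ σ : ℝ}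
    (hΛ : 0 < Λ) (hΛlam : Λ ≤ lam) (hlam1 : lam ≤ 1) (hc : 0 < c) (hβ : 0 < β) (hLr : 1 ≤ Lr) (hx₀ : 1 ≤ x₀) (hΛx : 1 ≤ Λ * x₀) (hlx : 1 ≤ lam * x₀)
    (hA : 0 ≤ A) (hd : 0 ≤ d) (hBa : 0 ≤ Ba) (hBa3 : 0 ≤ Ba3) (hε₂ : 0 ≤ ε₂) (he : 0 ≤ e₀)
    (hG₀ : 0 ≤ G₀) (hG₀g : G₀ ≤ g₀) (hGi₁ : Gi₁ = γ₁ * G₀) (hGi₂ : Gi₂ = γ₂ * G₀) (hGi₃ : Gi₃ = γ₃ * G₀) (hγ₁ : 0 ≤ γ₁) (hγ₂ : 0 ≤ γ₂) (hγ₃ : 0 ≤ γ₃)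
    (hKb₁ : 0 ≤ Kb₁) (hKb₂ : 0 ≤ Kb₂) (hK₃s : 0 ≤ K₃s) (hB₁ : 0 ≤ B₁) (hB₂ : 0 ≤ B₂) (hB₃ : 0 ≤ B₃) (hB₄ : 0 ≤ B₄)
    (hρf0 : 0 ≤ ρf) (hρfM : ρf ≤ ρfM) (hwsi0 : 0 ≤ wsi) (hw : wsi * lam ≤ w₀) (ha₃s : a₃s ≤ 𝔞₃ * lam ^ 2) (h𝔞₃ : 0 ≤ 𝔞₃)
    (hP2M : 0 < P2M) (hsM : s₀ * P2M ≤ 2 * σ * Λ * β) :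
    AΔs ≤ (G₀ / x₀ ^ 2) / (c * Λ ^ 2) * ((16 * B₁ + 16) +
      π ^ 3 * σ ^ 3 * ((128 * B₄ + 1216 * B₃ + 6912 * B₂ + 26112 * B₁ + 24576) + 3 * (2 * Gp₁) * (64 * B₃ + 416 * B₂ + 1600 * B₁ + 1536) +
        3 * (4 * Gp₂ + 2 * Gp₁) * (32 * B₂ + 128 * B₁ + 128) + (8 * Gp₃ + 12 * Gp₂) * (16 * B₁ + 16)) +
      ρ ^ 3 / 64 * (
        ((Real.sqrt 2 * (2 * π)) ^ 3 * ((128 * B₄ + 1408 * B₃ + 7776 * B₂ + 27648 * B₁ + 24576) * (Kb₁ + γ₁ * g₀) ^ 3 +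
          (64 * B₃ + 480 * B₂ + 1728 * B₁ + 1536) * γ₁ * (3 * Kb₁ ^ 2 + 3 * Kb₁ * (γ₁ * g₀) + (γ₁ * g₀) ^ 2) +
          3 * ((64 * B₃ + 480 * B₂ + 1728 * B₁ + 1536) * ((Kb₁ + γ₁ * g₀) * (Kb₂ + γ₂ * g₀)) + (32 * B₂ + 144 * B₁ + 128) * (Kb₁ * γ₂ + γ₁ * Kb₂ + γ₁ * γ₂ * g₀)) +
          ((32 * B₂ + 144 * B₁ + 128) * (K₃s + γ₃ * g₀) + (16 * B₁ + 16) * γ₃)) + 3 * ((2 * Gp₁ * ((4 + 2 * A) * (2 * π) + ε₂ * (ρfM + 4 * π) * (2 * π)) + 9 * (4 * Ba * ((1 + 2 * w₀) * (2 * (2 * π)))))) * (2 * (2 * π) ^ 2) * ((64 * B₃ + 480 * B₂ + 1728 * B₁ + 1536) * (Kb₁ + γ₁ * g₀) ^ 2 + (32 * B₂ + 144 * B₁ + 128) * γ₁ * (2 * Kb₁ + γ₁ * g₀) + (32 * B₂ + 144 * B₁ + 128) * (Kb₂ + γ₂ * g₀) + (16 * B₁ + 16) * γ₂) + 3 * (((4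 * Gp₂ + 2 * Gp₁) * ((4 + 2 * A) * (2 * π) + ε₂ * (ρfM + 4 * π) * (2 * π)) ^ 2 + 2 * Gp₁ * (ε₂ * (2 * π) ^ 2) +
          4 * Gp₁ * ((4 + 2 * A) * (2 * π) + ε₂ * (ρfM + 4 * π) * (2 * π)) * (9 * (4 * Ba * ((1 + 2 * w₀) * (2 * (2 * π))))) +
          9 * (4 * Ba * ((1 + 2 * w₀) * (2 * (2 * π))) ^ 2 + 8 * Ba ^ 2 * ((1 + 2 * w₀) * (2 * (2 * π))) ^ 2))) * (Real.sqrt 2 * (2 * π)) * ((32 * B₂ + 144 * B₁ + 128) * (Kb₁ + γ₁ * g₀) + (16 * B₁ + 16) * γ₁) + (κA + 16 * Gp₁ * 𝔞₃) * (2 * π) ^ 3 * (16 * B₁ + 16)) +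
        ((Real.sqrt 2 * (5 * π)) ^ 3 * ((128 * B₄ + 1408 * B₃ + 7776 * B₂ + 27648 * B₁ + 24576) * (Kb₁ + γ₁ * g₀) ^ 3 +
          (64 * B₃ + 480 * B₂ + 1728 * B₁ + 1536) * γ₁ * (3 * Kb₁ ^ 2 + 3 * Kb₁ * (γ₁ * g₀) + (γ₁ * g₀) ^ 2) +
          3 * ((64 * B₃ + 480 * B₂ + 1728 * B₁ + 1536) * ((Kb₁ + γ₁ * g₀) * (Kb₂ + γ₂ * g₀)) + (32 * B₂ + 144 * B₁ + 128) * (Kb₁ * γ₂ + γ₁ * Kb₂ + γ₁ * γ₂ * g₀)) +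
          ((32 * B₂ + 144 * B₁ + 128) * (K₃s + γ₃ * g₀) + (16 * B₁ + 16) * γ₃)) + 3 * ((2 * Gp₁ * ((4 + 2 * A) * (5 * π) + ε₂ * (ρfM + 10 * π) * (5 * π)) + 9 * (4 * Ba * ((1 + 2 * w₀) * (2 * (5 * π)))))) * (2 * (5 * π) ^ 2) * ((64 * B₃ + 480 * B₂ + 1728 * B₁ + 1536) * (Kb₁ + γ₁ * g₀) ^ 2 + (32 * B₂ + 144 * B₁ + 128) * γ₁ * (2 * Kb₁ + γ₁ * g₀) + (32 * B₂ + 144 * B₁ + 128) * (Kb₂ + γ₂ * g₀) + (16 * B₁ + 16) * γ₂) + 3 * (((4 * Gp₂ + 2 * Gp₁) * ((4 + 2 * A) * (5 * π) + ε₂ * (ρfM + 10 * π) * (5 * π)) ^ 2 + 2 * Gp₁ * (ε₂ * (5 * π) ^ 2) +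
          4 * Gp₁ * ((4 + 2 * A) * (5 * π) + ε₂ * (ρfM + 10 * π) * (5 * π)) * (9 * (4 * Ba * ((1 + 2 * w₀) * (2 * (5 * π))))) +
          9 * (4 * Ba * ((1 + 2 * w₀) * (2 * (5 * π))) ^ 2 + 8 * Ba ^ 2 * ((1 + 2 * w₀) * (2 * (5 * π))) ^ 2))) * (Real.sqrt 2 * (5 * π)) * ((32 * B₂ + 144 * B₁ + 128) * (Kb₁ + γ₁ * g₀) + (16 * B₁ + 16) * γ₁) + (κA + 16 * Gp₁ * 𝔞₃) * (5 * π) ^ 3 * (16 * B₁ + 16)) +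
        ((Real.sqrt 2 * (5 * π)) ^ 3 * ((128 * B₄ + 1408 * B₃ + 7776 * B₂ + 27648 * B₁ + 24576) * (Kb₁ + γ₁ * g₀) ^ 3 +
          (64 * B₃ + 480 * B₂ + 1728 * B₁ + 1536) * γ₁ * (3 * Kb₁ ^ 2 + 3 * Kb₁ * (γ₁ * g₀) + (γ₁ * g₀) ^ 2) +
          3 * ((64 * B₃ + 480 * B₂ + 1728 * B₁ + 1536) * ((Kb₁ + γ₁ * g₀) * (Kb₂ + γ₂ * g₀)) + (32 * B₂ + 144 * B₁ + 128) * (Kb₁ * γ₂ + γ₁ * Kb₂ + γ₁ * γ₂ * g₀)) +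
          ((32 * B₂ + 144 * B₁ + 128) * (K₃s + γ₃ * g₀) + (16 * B₁ + 16) * γ₃)) + 3 * ((2 * Gp₁ * ((2 * π) * (4 + 2 * A) + ε₂ * (ρfM + 10 * π) * (5 * π)) + 9 * (4 * Ba * ((1 + 2 * w₀) * (2 * (5 * π)))))) * (2 * (5 * π) ^ 2) * ((64 * B₃ + 480 * B₂ + 1728 * B₁ + 1536) * (Kb₁ + γ₁ * g₀) ^ 2 + (32 * B₂ + 144 * B₁ + 128) * γ₁ * (2 * Kb₁ + γ₁ * g₀) + (32 * B₂ + 144 * B₁ + 128) * (Kb₂ + γ₂ * g₀) + (16 * B₁ + 16) * γ₂) + 3 * (((4 * Gp₂ + 2 * Gp₁) * ((2 * π) * (4 + 2 * A) + ε₂ * (ρfM + 10 * π) * (5 * π)) ^ 2 + 2 * Gp₁ * (ε₂ * (5 * π) ^ 2) +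
          4 * Gp₁ * ((2 * π) * (4 + 2 * A) + ε₂ * (ρfM + 10 * π) * (5 * π)) * (9 * (4 * Ba * ((1 + 2 * w₀) * (2 * (5 * π))))) +
          9 * (4 * Ba * ((1 + 2 * w₀) * (2 * (5 * π))) ^ 2 + 8 * Ba ^ 2 * ((1 + 2 * w₀) * (2 * (5 * π))) ^ 2))) * (Real.sqrt 2 * (5 * π)) * ((32 * B₂ + 144 * B₁ + 128) * (Kb₁ + γ₁ * g₀) + (16 * B₁ + 16) * γ₁) + (κA + 16 * Gp₁ * 𝔞₃) * (5 * π) ^ 3 * (16 * B₁ + 16))) +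
      ρ₃ ^ 2 / 16 * (2 * (5 * π) ^ 2 * ((64 * B₃ + 480 * B₂ + 1728 * B₁ + 1536) * (Kb₁ + γ₁ * g₀) ^ 2 + (32 * B₂ + 144 * B₁ + 128) * γ₁ * (2 * Kb₁ + γ₁ * g₀) + (32 * B₂ + 144 * B₁ + 128) * (Kb₂ + γ₂ * g₀) + (16 * B₁ + 16) * γ₂) + 2 * ((2 * Gp₁ * ((2 * π) * (4 + 2 * A) + ε₂ * (ρfM + 10 * π) * (5 * π)) + 9 * (4 * Ba * ((1 + 2 * w₀) * (2 * (5 * π)))))) * (Real.sqrt 2 * (5 * π)) * ((32 * B₂ + 144 * B₁ + 128) * (Kb₁ + γ₁ * g₀) + (16 * B₁ + 16) * γ₁) + (((4 * Gp₂ + 2 * Gp₁) * ((2 * π) * (4 + 2 * A) + ε₂ * (ρfM + 10 * π) * (5 * π)) ^ 2 + 2 * Gp₁ * (ε₂ * (5 * π) ^ 2) +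
          4 * Gp₁ * ((2 * π) * (4 + 2 * A) + ε₂ * (ρfM + 10 * π) * (5 * π)) * (9 * (4 * Ba * ((1 + 2 * w₀) * (2 * (5 * π))))) +
          9 * (4 * Ba * ((1 + 2 * w₀) * (2 * (5 * π))) ^ 2 + 8 * Ba ^ 2 * ((1 + 2 * w₀) * (2 * (5 * π))) ^ 2))) * (16 * B₁ + 16))) := by
  have hπ := Real.pi_pos
  have hlam : 0 < lam := hΛ.trans_le hΛlam
  have hL0 : 0 < Lr := lt_of_lt_of_le one_pos hLr
  have hx₀0 : 0 < x₀ := lt_of_lt_of_le one_pos hx₀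
  have hGp₁0 : 0 ≤ Gp₁ := by rw [hGp₁]; positivity
  have hGp₂0 : 0 ≤ Gp₂ := by rw [hGp₂]; positivity
  have hGp₃0 : 0 ≤ Gp₃ := by rw [hGp₃]; positivity
  -- the defect polynomials and the time block
  obtain ⟨hX₀0, hX₁0, hX₂0, -, -, eX₀, bX₁, bX₂, bX₃, bTt⟩ := covX_le hΛ hΛlam hc hβ hx₀ hΛx hG₀ hG₀g hGi₁ hGi₂ hGi₃ hγ₁ hγ₂ hγ₃ hKb₁ hKb₂ hK₃s
    hB₁ hB₂ hB₃ hB₄ hGp₁0 hGp₂0 hGp₃0 hX₀s hX₁s hX₂s hX₃s hTts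
  -- the direction amplitudes: `L·A ≤ a ≤ 𝔞/Λ_m^{1,2}`
  obtain ⟨lAe1, lAe2, lAn1, lAn2, lAv1, lAv2, hAe10, hAe20, hAn10, hAn20, hAv10, hAv20, -, -⟩ :=
    rateAmps_pack' (G₁ := Gp₁) (G₂ := Gp₂) (Kp := ε₂) hLr hlam hA hBa hε₂ hwsi0 hρf0 hGp₁0 hGp₂0 hℓ₁ hℓ rfl rfl rfl rfl rfl rfl
    hAe1 hAe2 hAn1 hAn2 hAv1 hAv2
  obtain ⟨bae1, bae2, ban1, ban2, bav1, bav2⟩ := covAe_le' (Kp := ε₂) hlam hlam1 hA hBa hε₂ hwsi0 hw hρf0 hρfM hGp₁0 hGp₂0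
    rfl rfl rfl rfl rfl rfl
  -- the `κ` slot
  have hκs : (κA + κB) / (lam ^ 3 * x₀ ^ 3) ≤ κA + 16 * Gp₁ * 𝔞₃ := by
    have hκA0 : 0 ≤ κA := by rw [hκA]; positivity
    have hl3 : 1 ≤ lam ^ 3 * x₀ ^ 3 := by rw [← mul_pow]; exact one_le_pow₀ hlx
    have t1 : κA / (lam ^ 3 * x₀ ^ 3) ≤ κA := div_le_self hκA0 hl3
    have t2 : κB / (lam ^ 3 * x₀ ^ 3) ≤ 16 * Gp₁ * 𝔞₃ := by
      rw [hκB, div_le_iff₀ (by positivity)]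
      have u1 : a₃s * x₀ ≤ 𝔞₃ * lam ^ 2 * x₀ := mul_le_mul_of_nonneg_right ha₃s hx₀0.le
      have v1 : lam * x₀ ≤ lam * x₀ ^ 2 := mul_le_mul_of_nonneg_left (by nlinarith only [hx₀]) hlam.le
      have v : 1 ≤ lam * x₀ ^ 2 := hlx.trans v1
      have u2 : 𝔞₃ * lam ^ 2 * x₀ ≤ 𝔞₃ * (lam ^ 3 * x₀ ^ 3) := by
        have w : lam ^ 2 * x₀ ≤ lam ^ 2 * x₀ * (lam * x₀ ^ 2) := le_mul_of_one_le_right (by positivity) v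
        have e : lam ^ 2 * x₀ * (lam * x₀ ^ 2) = lam ^ 3 * x₀ ^ 3 := by ring
        rw [mul_assoc]; exact mul_le_mul_of_nonneg_left (w.trans_eq e) h𝔞₃
      calc 2 * Gp₁ * (8 * (a₃s * x₀)) = 16 * Gp₁ * (a₃s * x₀) := by ring
        _ ≤ 16 * Gp₁ * (𝔞₃ * (lam ^ 3 * x₀ ^ 3)) := mul_le_mul_of_nonneg_left (u1.trans u2) (by positivity)
        _ = _ := by ring
    rw [add_div]; exact add_le_add t1 t2
  have hg₀ : 0 ≤ g₀ := hG₀.trans hG₀g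
  have h := covDefect_ampRef_le (Nr := 2) hc hΛ hlam hL0 hβ hx₀ hlx hρ.le hs₀ hP2M hsM rfl (by positivity) hℓ₁ hℓ
    hAe10 hAe20 hAn10 hAn20 hAv10 hAv20
    (lAe1.trans bae1) (lAe2.trans bae2) (lAn1.trans ban1) (lAn2.trans ban2) (lAv1.trans bav1) (lAv2.trans bav2)
    hX₀0 hX₁0 hX₂0 (by positivity) (by positivity) (by positivity) (by positivity) eX₀ bX₁ bX₂ bX₃ bTt hκs hAΔs
  exact h

end Pack

end Summit.HubbardSuperconductivity.HubbardSuperconductivity.Theorems.TorusFourierL2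

end
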